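import Literature.AlgebraicTopology.SingularHomology.MayerVietorisExactness
import Literature.AlgebraicTopology.SingularHomology.ExcisionTheorem
import HarnessLib

/-!
# Mayer–Vietoris: when one piece and the overlap are acyclic, the other piece carries the homology

A. Hatcher, *Algebraic Topology* (2002), §2.2 p. 149: for `X = U ∪ V` with
`interior U ∪ interior V = X` the Mayer–Vietoris sequence
`Hₙ₊₁(U ∩ V) ⟶φ Hₙ₊₁(U) ⊞ Hₙ₊₁(V) ⟶ψ Hₙ₊₁(X) ⟶δ Hₙ(U ∩ V) ⟶φ Hₙ(U) ⊞ Hₙ(V)` is exact. Hence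
**if `Hₙ₊₁(U ∩ V) = 0`, `Hₙ₊₁(U) = 0` and `Hₙ(U ∩ V) → Hₙ(U)` is a monomorphism, then the
inclusion `V ↪ X` induces an isomorphism `Hₙ₊₁(V) ≅ Hₙ₊₁(X)`** (`δ = 0` since the following
`φ` is mono, so `ψ` is onto; `φ = 0` on `Hₙ₊₁(U ∩ V) = 0`, so `ψ` is into; and
`Hₙ₊₁(V) = Hₙ₊₁(U) ⊞ Hₙ₊₁(V)`). This is the situation of the standard computation of the
homology of `ℂPⁿ = ℂPⁿ⁻¹ ∪ e²ⁿ` from the cover by the complement of a point (`≃ ℂPⁿ⁻¹`) and an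
affine chart (contractible), whose overlap is `ℂⁿ ∖ 0 ≃ S²ⁿ⁻¹` (Hatcher Example 2.42-style / the
cellular computation); the degree-zero monomorphism hypothesis is met when `U ∩ V` and `U` are
path connected (`singularHomology.isIso_map_zero_of_pathConnectedSpace`).

Everything is proved, from the tree's proved exactness (`mayerVietoris.exact₁/₂/₃_holds`) and
excision (`relativeSingularHomology.isIso_map_of_interior_union_interior_holds`); companion of
`mayerVietoris.isIso_map_inter_left_of_isZero` (`ContractiblePunctured.lean`).

## Main statements

* `isIso_biprod_inr_of_isZero` — `inr : B ⟶ A ⊞ B` is an isomorphism when `A = 0`.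
* `mayerVietoris.isIso_map_right_of_isZero` — the criterion above.
* `mayerVietoris.isIso_map_right_of_isZero_of_isZero` — the variant with `Hₙ(U ∩ V) = 0` in place
  of the monomorphism hypothesis.

## References

* A. Hatcher, *Algebraic Topology*, CUP 2002, §2.2 p. 149 (Mayer–Vietoris sequences).
  [Hatcher2002]
-/

noncomputable section

open CategoryTheory CategoryTheory.Limits Set

universe u v

namespace Literature.AlgebraicTopology.SingularHomology

variable (R : Type v) [CommRing R] (M : Type v) [AddCommGroup M] [Module R M]
variable {X : Type u} [TopologicalSpace X]

/-- In a binary biproduct with zero first summand the second inclusion is an isomorphism.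
[folklore] -/
theorem isIso_biprod_inr_of_isZero {C : Type*} [Category C] [Preadditive C] {A B : C}
    [HasBinaryBiproduct A B] (hA : IsZero A) : IsIso (biprod.inr : B ⟶ A ⊞ B) := by
  refine ⟨⟨biprod.snd, biprod.inr_snd, ?_⟩⟩
  refine biprod.hom_ext' _ _ ?_ ?_
  · exact hA.eq_of_src _ _
  · rw [biprod.inr_snd_assoc, Category.comp_id]

/-- **Mayer–Vietoris isomorphism criterion (right piece).** Let `X = U ∪ V` with
`interior U ∪ interior V = X`. If `Hₙ₊₁(U ∩ V; M) = 0`, `Hₙ₊₁(U; M) = 0` and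
`Hₙ(U ∩ V; M) → Hₙ(U; M)` is a monomorphism, then the inclusion `V ↪ X` induces an isomorphism
`Hₙ₊₁(V; M) ≅ Hₙ₊₁(X; M)`: in `Hₙ₊₁(U ∩ V) ⟶φ Hₙ₊₁(U) ⊞ Hₙ₊₁(V) ⟶ψ Hₙ₊₁(X) ⟶δ Hₙ(U ∩ V) ⟶φ …`
the map `δ` vanishes (the next `φ` is into), so `ψ` is onto, and `ψ` is into (`φ = 0`), while
`Hₙ₊₁(V) ⟶inr Hₙ₊₁(U) ⊞ Hₙ₊₁(V)` is an isomorphism (Hatcher 2002, §2.2 p. 149).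
[cite: Hatcher2002, §2.2 p. 149] -/
theorem mayerVietoris.isIso_map_right_of_isZero (U V : Set X)
    (hUV : interior U ∪ interior V = univ) (n : ℕ)
    (hI : IsZero (singularHomology R M ↥(U ∩ V) (n + 1)))
    (hU : IsZero (singularHomology R M U (n + 1)))
    (hmono : Mono (singularHomology.map R M
      (subsetInclusion (inter_subset_left : U ∩ V ⊆ U)) n)) :
    IsIso (singularHomology.map R M (subsetIncl V) (n + 1)) := by
  have hexc := relativeSingularHomology.isIso_map_of_interior_union_interior_holds R M X
  -- `φₙ` is a monomorphism (its first component is), hence `δ = 0` and `ψₙ₊₁` is onto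
  haveI hφ : Mono (mayerVietoris.φ R M U V n) := by
    have hfac : mayerVietoris.φ R M U V n ≫ biprod.fst = singularHomology.map R M
        (subsetInclusion (inter_subset_left : U ∩ V ⊆ U)) n := biprod.lift_fst _ _
    haveI : Mono (mayerVietoris.φ R M U V n ≫ biprod.fst) := by rw [hfac]; exact hmono
    exact mono_of_mono _ (biprod.fst : singularHomology R M U n ⊞ singularHomology R M V n ⟶ _)
  have hδ : mayerVietoris.δ R M U V hexc hUV n = 0 :=
    (cancel_mono (mayerVietoris.φ R M U V n)).1
      ((mayerVietoris.δ_comp_φ R M U V hexc hUV n).trans (zero_comp).symm)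
  haveI hepi : Epi (mayerVietoris.ψ R M U V (n + 1)) :=
    (mayerVietoris.exact₂_holds R M U V hexc hUV n).epi_f hδ
  -- `φₙ₊₁ = 0`, hence `ψₙ₊₁` is into
  have hφ0 : mayerVietoris.φ R M U V (n + 1) = 0 := hI.eq_of_src _ _
  haveI hmono' : Mono (mayerVietoris.ψ R M U V (n + 1)) :=
    (mayerVietoris.exact₁_holds R M U V hUV (n + 1)).mono_g hφ0
  haveI : IsIso (mayerVietoris.ψ R M U V (n + 1)) := isIso_of_mono_of_epi _
  haveI := isIso_biprod_inr_of_isZero (B := singularHomology R M V (n + 1)) hU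
  have hfac : singularHomology.map R M (subsetIncl V) (n + 1) =
      biprod.inr ≫ mayerVietoris.ψ R M U V (n + 1) := (biprod.inr_desc _ _).symm
  rw [hfac]
  infer_instance

/-- **Mayer–Vietoris isomorphism criterion (right piece), acyclic overlap.** If
`Hₙ₊₁(U ∩ V) = Hₙ(U ∩ V) = 0` and `Hₙ₊₁(U) = 0` then `Hₙ₊₁(V) ≅ Hₙ₊₁(X)` by the inclusion
(Hatcher 2002, §2.2 p. 149). [cite: Hatcher2002, §2.2 p. 149] -/
theorem mayerVietoris.isIso_map_right_of_isZero_of_isZero (U V : Set X)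
    (hUV : interior U ∪ interior V = univ) (n : ℕ)
    (hI : IsZero (singularHomology R M ↥(U ∩ V) (n + 1)))
    (hI' : IsZero (singularHomology R M ↥(U ∩ V) n))
    (hU : IsZero (singularHomology R M U (n + 1))) :
    IsIso (singularHomology.map R M (subsetIncl V) (n + 1)) :=
  mayerVietoris.isIso_map_right_of_isZero R M U V hUV n hI hU
    ⟨fun _ _ _ ↦ hI'.eq_of_tgt _ _⟩

end Literature.AlgebraicTopology.SingularHomology
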